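import Summits.CriticalPhenomena.PercolationContinuityZ3.Theorems.Transplant.FKConnectivityAllQPat3TwoLevelFunctionals
import Summits.CriticalPhenomena.PercolationContinuityZ3.Theorems.Transplant.FKConnectivityAllQPat3Gluing
import Summits.CriticalPhenomena.PercolationContinuityZ3.Theorems.Transplant.FKConnectivityAllQPat3T2Defs
import HarnessLib

/-!
# Connectivity correlation inequalities for `φ_{w,q}`, every `q > 0` — THE CLOSED-FAMILY INDUCTION over two-terminal
# series–parallel networks, and THEOREM 𝒯₁ COMPLETED: `STAR(x;y,s)`, `STAR(y;x,s)`, `STAR(s;x,y)` (and `T_sym`) `≥ 0` levelwise on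
# every such network with an inner third mark; THEOREM 𝒯₂ (all fourteen members of 𝒯₁ ∪ 𝒯₂)

Theorems file (`--supports stmt-CriticalPhenomena-4575`), census lane `prim-bschramm-census` (gen 36) of the post-continuity programme (LANE 2 bschramm, FK sub-lane);
builds on p205010 (kernel theorem, internal audit signed; external expert review pending).
No definitions, no named facts, no sorries; standard axioms.  KERNEL STATUS: with `…TsymSP.lean` (`T_sym`, one-level form) and this
file the lane's THEOREM 𝒯₁ (census g33; PROOF-THEOREM-SP §3) is a kernel theorem; THEOREM 𝒯₂ follows in `…Pat3T2SP.lean` from the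
same induction lemma; Stages S2–S4 of census g35's blueprint (THETA/RING certificates, 3C, Lemma Θ₃) remain.
* `FK.mval2_par_nonneg` / `serL` / `serR` / `serS` — the four gluing steps for an arbitrary two-level member with class-dependent
  dominating members valid on the marked part.
* `FK.fam_nonneg_of_isTTSP` — INDUCTION LEMMA FOR CLOSED FAMILIES (census g33 §3.3 / g34 §2.3, fibre normal form): a family
  passing `FK.certGlueFam` for PAR / SER-L / SER-R and `FK.certSerSFam` is nonnegative, member by member, for all nonnegative
  weights, on every `FK.IsTTSP E x y` with an inner mark `s` — structural induction carrying all members at once.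
* `FK.starX_nonneg`, `FK.starY_nonneg` (via `IsTTSP.symm`), `FK.starS_nonneg`, `FK.tsym2_nonneg` (singleton families);
  levelwise count forms `FK.starX_level_nonneg`, `FK.starS_level_nonneg`.
* THEOREM 𝒯₂ (census g34 §3): `FK.famT12_nonneg` — all fourteen members of `FK.famT12` (`…Pat3T2Defs.lean`: `T_sym, STAR_x, STAR_y,
  STAR_s, C1, C2, C3, S¹C1, S¹C3` and mirrors) are nonnegative for all nonnegative weights on every `IsTTSP` network with an inner
  mark; named `FK.c1_nonneg`, `c2_nonneg`, `c3_nonneg`, `s1c1_nonneg`, `s1c3_nonneg`, `c1_mirror_nonneg`.  This completes Stage S1 of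
  census g35's blueprint: every generator of the THETA/RING certificates is in table form (with `…Pat3URect.lean` for the
  Theorem-U rectangles); Stage S2 (the four multilinear certificates) is next.
[cite: AyyerLinussonRavichandran2025, §7 eq. (13)–(15) (p. 22)] [cite: Grimmett2006, §3.8 (pp. 61–62)]
-/

noncomputable section

namespace Summit.CriticalPhenomena.PercolationContinuityZ3.Theorems

namespace FK

open SimpleGraph Literature.Probability.LatticeModels Literature.Probability.Percolation

open scoped Classical

variable {V : Type*}

section Steps

variable [Fintype V]

/-- **Two-level member, PARALLEL step**: `A = E_A` a two-terminal `(x, y)`-part, `B = E_B` an `(x, y)`-part carrying the inner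
mark `s`; a doubled/symmetrised domination of the class fibres by members `G a a'` valid on `B` transfers nonnegativity to the
union. [folklore] -/
theorem mval2_par_nonneg {EA EB : Finset (Sym2 V)} {VA VB : Set V} (hd : Disjoint EA EB)
    (hA : ∀ e ∈ (↑EA : Set (Sym2 V)), ∀ z ∈ e, z ∈ VA) (hB : ∀ e ∈ (↑EB : Set (Sym2 V)), ∀ z ∈ e, z ∈ VB)
    {x y s : V} (hS : VA ∩ VB ⊆ {x, y}) (hxy : x ≠ y) (hsV : s ∉ VA) (hsx : s ≠ x) (hsy : s ≠ y)
    {F : ℕ → Pat3 → Pat3 → ℤ} {G : Bool → Bool → ℕ → Pat3 → Pat3 → ℤ} {m k : Bool → Bool → ℕ} (hk : ∀ a a', k a a' + 1 < 4)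
    (hdom : ∀ a a', ∀ c < 4, ∀ P Q,
      (m a a' : ℤ) * (shift2 (G a a') (k a a') c P Q + shift2 (G a a') (k a a') c Q P) ≤
        2 * ((fib2 F joinPar corrPar a a' c P Q + fib2 F joinPar corrPar a' a c P Q) +
          (fib2 F joinPar corrPar a a' c Q P + fib2 F joinPar corrPar a' a c Q P)))
    (ihG : ∀ a a', ∀ w' : ℕ → ℝ, (∀ n, 0 ≤ w' n) → 0 ≤ mval2 w' EB x y s (G a a'))
    (w : ℕ → ℝ) (hw : ∀ n, 0 ≤ w n) : 0 ≤ mval2 w (EA ∪ EB) x y s F := by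
  refine mval2_union_nonneg hd (fun γ => conn γ x y) joinPar corrPar
    (fun γA hγA γB hγB => pat3_union_par hA hB hS hsV hsx hsy hγA hγB)
    (fun γA hγA γB hγB => ?_) (by decide) F G m k hk hdom ihG w hw
  rw [apExp_parallel hd hA hB hS hxy le_rfl le_rfl hγA hγB, ite_and_eq_corrPar γA γB x y s,
    ite_and_eq_corrPar (EA \ γA) (EB \ γB) x y s]

/-- **Two-level member, SERIES step with the mark in the second part**: `E₁` an `(x, m₀)`-part, `E₂` an `(m₀, y)`-part carrying
the inner mark `s ≠ m₀`; the dominating members `G a a'` are valid on `(E₂; m₀, y, s)`. [folklore] -/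
theorem mval2_serL_nonneg {E₁ E₂ : Finset (Sym2 V)} {V₁ V₂ : Set V} (hd : Disjoint E₁ E₂)
    (h₁ : ∀ e ∈ (↑E₁ : Set (Sym2 V)), ∀ z ∈ e, z ∈ V₁) (h₂ : ∀ e ∈ (↑E₂ : Set (Sym2 V)), ∀ z ∈ e, z ∈ V₂)
    {x m₀ y s : V} (hS : V₁ ∩ V₂ ⊆ {m₀}) (hxV : x ∉ V₂) (hyV : y ∉ V₁) (hsV : s ∉ V₁) (hxm : x ≠ m₀) (hym : y ≠ m₀)
    (hxy : x ≠ y) (hsm : s ≠ m₀) (hxs : x ≠ s)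
    {F : ℕ → Pat3 → Pat3 → ℤ} {G : Bool → Bool → ℕ → Pat3 → Pat3 → ℤ} {m k : Bool → Bool → ℕ} (hk : ∀ a a', k a a' + 1 < 4)
    (hdom : ∀ a a', ∀ c < 4, ∀ P Q,
      (m a a' : ℤ) * (shift2 (G a a') (k a a') c P Q + shift2 (G a a') (k a a') c Q P) ≤
        2 * ((fib2 F joinSerL corrZero a a' c P Q + fib2 F joinSerL corrZero a' a c P Q) +
          (fib2 F joinSerL corrZero a a' c Q P + fib2 F joinSerL corrZero a' a c Q P)))
    (ihG : ∀ a a', ∀ w' : ℕ → ℝ, (∀ n, 0 ≤ w' n) → 0 ≤ mval2 w' E₂ m₀ y s (G a a'))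
    (w : ℕ → ℝ) (hw : ∀ n, 0 ≤ w n) : 0 ≤ mval2 w (E₁ ∪ E₂) x y s F := by
  refine mval2_union_nonneg hd (fun γ => conn γ x m₀) joinSerL corrZero
    (fun γA hγA γB hγB => pat3_union_serL h₁ h₂ hS hxV hyV hsV hxm hym hxy hsm hxs hγA hγB)
    (fun γA hγA γB hγB => ?_) (by decide) F G m k hk hdom ihG w hw
  simp only [corrZero, add_zero]
  exact apExp_series hd h₁ h₂ hS le_rfl le_rfl hγA hγB

/-- **Two-level member, SERIES step with the mark in the first part**: `E₁` an `(x, m₀)`-part carrying the inner mark `s ≠ m₀`,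
`E₂` an `(m₀, y)`-part; the dominating members are valid on `(E₁; x, m₀, s)`. [folklore] -/
theorem mval2_serR_nonneg {E₁ E₂ : Finset (Sym2 V)} {V₁ V₂ : Set V} (hd : Disjoint E₁ E₂)
    (h₁ : ∀ e ∈ (↑E₁ : Set (Sym2 V)), ∀ z ∈ e, z ∈ V₁) (h₂ : ∀ e ∈ (↑E₂ : Set (Sym2 V)), ∀ z ∈ e, z ∈ V₂)
    {x m₀ y s : V} (hS : V₁ ∩ V₂ ⊆ {m₀}) (hxV : x ∉ V₂) (hsV : s ∉ V₂) (hyV : y ∉ V₁) (hxm : x ≠ m₀) (hym : y ≠ m₀)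
    (hxy : x ≠ y) (hsm : s ≠ m₀) (hsy : s ≠ y)
    {F : ℕ → Pat3 → Pat3 → ℤ} {G : Bool → Bool → ℕ → Pat3 → Pat3 → ℤ} {m k : Bool → Bool → ℕ} (hk : ∀ a a', k a a' + 1 < 4)
    (hdom : ∀ a a', ∀ c < 4, ∀ P Q,
      (m a a' : ℤ) * (shift2 (G a a') (k a a') c P Q + shift2 (G a a') (k a a') c Q P) ≤
        2 * ((fib2 F joinSerR corrZero a a' c P Q + fib2 F joinSerR corrZero a' a c P Q) +
          (fib2 F joinSerR corrZero a a' c Q P + fib2 F joinSerR corrZero a' a c Q P)))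
    (ihG : ∀ a a', ∀ w' : ℕ → ℝ, (∀ n, 0 ≤ w' n) → 0 ≤ mval2 w' E₁ x m₀ s (G a a'))
    (w : ℕ → ℝ) (hw : ∀ n, 0 ≤ w n) : 0 ≤ mval2 w (E₁ ∪ E₂) x y s F := by
  rw [Finset.union_comm]
  refine mval2_union_nonneg hd.symm (fun γ => conn γ m₀ y) joinSerR corrZero
    (fun γA hγA γB hγB => ?_) (fun γA hγA γB hγB => ?_) (by decide) F G m k hk hdom ihG w hw
  · rw [Finset.union_comm]
    exact pat3_union_serR h₁ h₂ hS hxV hsV hyV hxm hym hxy hsm hsy hγB hγA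
  · simp only [corrZero, add_zero]
    rw [Finset.union_comm E₂, Finset.union_comm γA, add_comm (apExp E₂ γA)]
    exact apExp_series hd h₁ h₂ hS le_rfl le_rfl hγB hγA

/-- **Two-level member, SERIES step at the mark**: `E₁` an `(x, s)`-part and `E₂` an `(s, y)`-part. [folklore] -/
theorem mval2_serS_nonneg {E₁ E₂ : Finset (Sym2 V)} {V₁ V₂ : Set V} (hd : Disjoint E₁ E₂)
    (h₁ : ∀ e ∈ (↑E₁ : Set (Sym2 V)), ∀ z ∈ e, z ∈ V₁) (h₂ : ∀ e ∈ (↑E₂ : Set (Sym2 V)), ∀ z ∈ e, z ∈ V₂)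
    {x s y : V} (hS : V₁ ∩ V₂ ⊆ {s}) (hxV : x ∉ V₂) (hyV : y ∉ V₁) (hxs : x ≠ s) (hys : y ≠ s) (hxy : x ≠ y)
    {F : ℕ → Pat3 → Pat3 → ℤ}
    (hcert : ∀ a a' b b' : Bool, ∀ c < 2, 0 ≤ F c (joinSerS a b) (joinSerS a' b') + F c (joinSerS a b') (joinSerS a' b))
    (w : ℕ → ℝ) (hw : ∀ n, 0 ≤ w n) : 0 ≤ mval2 w (E₁ ∪ E₂) x y s F :=
  mval2_union_nonneg₂ hd (fun γ => conn γ x s) (fun γ => conn γ s y)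
    (fun _ hγ₁ _ hγ₂ => pat3_union_serS h₁ h₂ hS hxV hyV hxs hys hxy hγ₁ hγ₂)
    (fun _ hγ₁ _ hγ₂ => apExp_series hd h₁ h₂ hS le_rfl le_rfl hγ₁ hγ₂) F hcert w hw

end Steps

/-! ### The induction for a CLOSED FAMILY of two-level members -/

section Induction

variable [Fintype V]

/-- Members beyond the end of the family are the zero table. [folklore] -/
theorem famGet_of_le {Fam : List (ℕ → Pat3 → Pat3 → ℤ)} {i : ℕ} (hi : Fam.length ≤ i) :
    famGet Fam i = fun _ _ _ => 0 := by
  unfold famGet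
  exact List.getD_eq_default _ _ hi

/-- **INDUCTION LEMMA FOR CLOSED FAMILIES (census g33 §3.3 / g34 PROOF-THEOREM-SP §2.3; kernel).**  Let `Fam` be a finite family of
two-level three-mark members (positional in `(terminal, terminal, inner mark)`) that passes the family certificate checks for
the four gluing situations — PARALLEL (`certGlueFam Fam joinPar corrPar selP`), SERIES with the mark in the second part
(`… joinSerL corrZero selL`), SERIES with the mark in the first part (`… joinSerR corrZero selR`), SERIES at the mark
(`certSerSFam Fam`) — i.e. every fibre of every member is, after symmetrisation, termwise nonnegative or dominates a (half-)multiple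
of SOME member of the family on the marked part.  Then EVERY member is nonnegative, for all nonnegative weights (hence levelwise),
on every two-terminal series–parallel network `E` between `x` and `y` with an inner vertex `s`.  (Structural induction over
`FK.IsTTSP` carrying all members at once; a single edge has no inner vertex.)
[cite: AyyerLinussonRavichandran2025, §7 (p. 22)] [cite: Grimmett2006, §3.8 (pp. 61–62)] -/
theorem fam_nonneg_of_isTTSP {Fam : List (ℕ → Pat3 → Pat3 → ℤ)} {selP selL selR : ℕ → Bool → Bool → ℕ × ℕ × ℕ}
    (hP : certGlueFam Fam joinPar corrPar selP = true) (hL : certGlueFam Fam joinSerL corrZero selL = true)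
    (hR : certGlueFam Fam joinSerR corrZero selR = true) (hS : certSerSFam Fam = true)
    {E : Finset (Sym2 V)} {x y : V} (hE : IsTTSP E x y) :
    ∀ s : V, (∃ e ∈ E, s ∈ e) → s ≠ x → s ≠ y →
      ∀ w : ℕ → ℝ, (∀ n, 0 ≤ w n) → ∀ i : ℕ, 0 ≤ mval2 w E x y s (famGet Fam i) := by
  induction hE with
  | @edge a b hab =>
    intro s hs hsa hsb w hw i
    obtain ⟨e, he, hse⟩ := hs
    rw [Finset.mem_singleton] at he
    subst he
    rcases Sym2.mem_iff.1 hse with h | h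
    · exact absurd h hsa
    · exact absurd h hsb
  | @series E₁ E₂ a m₀ b h₁ h₂ hd hV ha hb ih₁ ih₂ =>
    intro s hs hsa hsb w hw i
    by_cases hi : Fam.length ≤ i
    · rw [famGet_of_le hi, mval2_zero]
    have hi' : i < Fam.length := lt_of_not_ge hi
    have g₁ : ∀ e ∈ (↑E₁ : Set (Sym2 V)), ∀ z ∈ e, z ∈ {z : V | ∃ e ∈ E₁, z ∈ e} := fun e he z hz => ⟨e, he, hz⟩
    have g₂ : ∀ e ∈ (↑E₂ : Set (Sym2 V)), ∀ z ∈ e, z ∈ {z : V | ∃ e ∈ E₂, z ∈ e} := fun e he z hz => ⟨e, he, hz⟩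
    have gS : {z : V | ∃ e ∈ E₁, z ∈ e} ∩ {z : V | ∃ e ∈ E₂, z ∈ e} ⊆ ({m₀} : Set V) :=
      fun z hz => hV z hz.1 hz.2
    have gaV₂ : a ∉ {z : V | ∃ e ∈ E₂, z ∈ e} := fun ⟨e, he, hae⟩ => ha e he hae
    have gbV₁ : b ∉ {z : V | ∃ e ∈ E₁, z ∈ e} := fun ⟨e, he, hbe⟩ => hb e he hbe
    have gam : a ≠ m₀ := by
      obtain ⟨e, he, hme⟩ := h₂.left_mem
      intro ham; exact ha e he (ham ▸ hme)
    have gbm : b ≠ m₀ := by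
      obtain ⟨e, he, hme⟩ := h₁.right_mem
      intro hbm; exact hb e he (hbm ▸ hme)
    have gab : a ≠ b := by
      obtain ⟨e, he, hae⟩ := h₁.left_mem
      intro hab; exact hb e he (hab ▸ hae)
    by_cases hsm : s = m₀
    · subst hsm
      exact mval2_serS_nonneg hd g₁ g₂ gS gaV₂ gbV₁ gam gbm gab (certSerSFam_spec hS hi') w hw
    · obtain ⟨e, he, hse⟩ := hs
      rcases Finset.mem_union.1 he with he₁ | he₂
      · have hsV₂ : s ∉ {z : V | ∃ e ∈ E₂, z ∈ e} := fun hs₂ => hsm (hV s ⟨e, he₁, hse⟩ hs₂)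
        exact mval2_serR_nonneg hd g₁ g₂ gS gaV₂ hsV₂ gbV₁ gam gbm gab hsm hsb
          (G := fun a' a'' => famGet Fam (selR i a' a'').1) (m := fun a' a'' => (selR i a' a'').2.1)
          (k := fun a' a'' => (selR i a' a'').2.2) (fun a' a'' => (certGlueFam_spec hR hi' a' a'').1)
          (fun a' a'' => (certGlueFam_spec hR hi' a' a'').2)
          (fun a' a'' w' hw' => ih₁ s ⟨e, he₁, hse⟩ hsa hsm w' hw' _) w hw
      · have hsV₁ : s ∉ {z : V | ∃ e ∈ E₁, z ∈ e} := fun hs₁ => hsm (hV s hs₁ ⟨e, he₂, hse⟩)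
        have has : a ≠ s := fun h => gaV₂ (h ▸ ⟨e, he₂, hse⟩)
        exact mval2_serL_nonneg hd g₁ g₂ gS gaV₂ gbV₁ hsV₁ gam gbm gab hsm has
          (G := fun a' a'' => famGet Fam (selL i a' a'').1) (m := fun a' a'' => (selL i a' a'').2.1)
          (k := fun a' a'' => (selL i a' a'').2.2) (fun a' a'' => (certGlueFam_spec hL hi' a' a'').1)
          (fun a' a'' => (certGlueFam_spec hL hi' a' a'').2)
          (fun a' a'' w' hw' => ih₂ s ⟨e, he₂, hse⟩ hsm hsb w' hw' _) w hw
  | @parallel E₁ E₂ a b h₁ h₂ hd hV ih₁ ih₂ =>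
    intro s hs hsa hsb w hw i
    by_cases hi : Fam.length ≤ i
    · rw [famGet_of_le hi, mval2_zero]
    have hi' : i < Fam.length := lt_of_not_ge hi
    have g₁ : ∀ e ∈ (↑E₁ : Set (Sym2 V)), ∀ z ∈ e, z ∈ {z : V | ∃ e ∈ E₁, z ∈ e} := fun e he z hz => ⟨e, he, hz⟩
    have g₂ : ∀ e ∈ (↑E₂ : Set (Sym2 V)), ∀ z ∈ e, z ∈ {z : V | ∃ e ∈ E₂, z ∈ e} := fun e he z hz => ⟨e, he, hz⟩
    have gS : {z : V | ∃ e ∈ E₁, z ∈ e} ∩ {z : V | ∃ e ∈ E₂, z ∈ e} ⊆ ({a, b} : Set V) := by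
      intro z hz
      rcases hV z hz.1 hz.2 with h | h
      · exact Or.inl h
      · exact Or.inr h
    have gS' : {z : V | ∃ e ∈ E₂, z ∈ e} ∩ {z : V | ∃ e ∈ E₁, z ∈ e} ⊆ ({a, b} : Set V) :=
      fun z hz => gS ⟨hz.2, hz.1⟩
    have gab : a ≠ b := h₁.ne
    obtain ⟨e, he, hse⟩ := hs
    rcases Finset.mem_union.1 he with he₁ | he₂
    · have hsV₂ : s ∉ {z : V | ∃ e ∈ E₂, z ∈ e} := by
        intro hs₂
        rcases hV s ⟨e, he₁, hse⟩ hs₂ with h | h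
        · exact hsa h
        · exact hsb h
      rw [Finset.union_comm]
      exact mval2_par_nonneg hd.symm g₂ g₁ gS' gab hsV₂ hsa hsb
        (G := fun a' a'' => famGet Fam (selP i a' a'').1) (m := fun a' a'' => (selP i a' a'').2.1)
        (k := fun a' a'' => (selP i a' a'').2.2) (fun a' a'' => (certGlueFam_spec hP hi' a' a'').1)
        (fun a' a'' => (certGlueFam_spec hP hi' a' a'').2)
        (fun a' a'' w' hw' => ih₁ s ⟨e, he₁, hse⟩ hsa hsb w' hw' _) w hw
    · have hsV₁ : s ∉ {z : V | ∃ e ∈ E₁, z ∈ e} := by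
        intro hs₁
        rcases hV s hs₁ ⟨e, he₂, hse⟩ with h | h
        · exact hsa h
        · exact hsb h
      exact mval2_par_nonneg hd g₁ g₂ gS gab hsV₁ hsa hsb
        (G := fun a' a'' => famGet Fam (selP i a' a'').1) (m := fun a' a'' => (selP i a' a'').2.1)
        (k := fun a' a'' => (selP i a' a'').2.2) (fun a' a'' => (certGlueFam_spec hP hi' a' a'').1)
        (fun a' a'' => (certGlueFam_spec hP hi' a' a'').2)
        (fun a' a'' w' hw' => ih₂ s ⟨e, he₂, hse⟩ hsa hsb w' hw' _) w hw

end Induction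

/-! ### THEOREM 𝒯₁: `T_sym`, `STAR(x;y,s)`, `STAR(y;x,s)`, `STAR(s;x,y)` -/

section T1

variable [Fintype V] {E : Finset (Sym2 V)} {x y s : V}

/-- **THEOREM 𝒯₁ (`STAR`, apex = a terminal; census g33/g34 THEOREM SP §3, house result — here a kernel theorem).**  For every
two-terminal series–parallel network `E` between `x` and `y`, every inner vertex `s` and every nonnegative weight sequence `w`:
`0 ≤ mval2 w E x y s starXTab`, i.e. at every level `ν`,
`STAR(x; y, s)(ν) = 2[n{xy|s;xs|y} + n{xy|s;x|ys} + n{xs|y;x|ys} + n{x|ys;x|ys} + n{x|ys;⊥} − n{⊤;⊥}](ν) + 2[n{⊤;x|ys} + n{⊤;⊥} − n{xy|s;xs|y}](ν−1) ≥ 0`.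
PROOF: `FK.fam_nonneg_of_isTTSP` for the singleton family `{STAR_x}` with the `decide`d checks `famStarX_cert_*` (census g35's
fibre normal form: `STAR_x` is a closed family by itself). [cite: AyyerLinussonRavichandran2025, §7 (p. 22)] -/
theorem starX_nonneg (hE : IsTTSP E x y) (hs : ∃ e ∈ E, s ∈ e) (hsx : s ≠ x) (hsy : s ≠ y) {w : ℕ → ℝ}
    (hw : ∀ n, 0 ≤ w n) : 0 ≤ mval2 w E x y s starXTab :=
  fam_nonneg_of_isTTSP famStarX_cert_par famStarX_cert_serL famStarX_cert_serR famStarX_cert_serS hE s hs hsx hsy w hw 0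

/-- **THEOREM 𝒯₁ (`STAR`, apex = the other terminal)**: `0 ≤ mval2 w E y x s starXTab` (`STAR(y; x, s) ≥ 0` levelwise), by the
symmetry of two-terminal networks (`IsTTSP.symm`). [cite: AyyerLinussonRavichandran2025, §7 (p. 22)] -/
theorem starY_nonneg (hE : IsTTSP E x y) (hs : ∃ e ∈ E, s ∈ e) (hsx : s ≠ x) (hsy : s ≠ y) {w : ℕ → ℝ}
    (hw : ∀ n, 0 ≤ w n) : 0 ≤ mval2 w E y x s starXTab :=
  starX_nonneg hE.symm hs hsy hsx hw

/-- **THEOREM 𝒯₁ (`STAR`, apex = the inner mark)**: `0 ≤ mval2 w E x y s starSTab`, i.e. at every level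
`STAR(s; x, y)(ν) = 2[n{xs|y;x|ys} + n{xs|y;xy|s} + n{x|ys;xy|s} + n{xy|s;xy|s} + n{xy|s;⊥} − n{⊤;⊥}](ν) + 2[n{⊤;xy|s} + n{⊤;⊥} − n{xs|y;x|ys}](ν−1) ≥ 0`.
[cite: AyyerLinussonRavichandran2025, §7 (p. 22)] -/
theorem starS_nonneg (hE : IsTTSP E x y) (hs : ∃ e ∈ E, s ∈ e) (hsx : s ≠ x) (hsy : s ≠ y) {w : ℕ → ℝ}
    (hw : ∀ n, 0 ≤ w n) : 0 ≤ mval2 w E x y s starSTab :=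
  fam_nonneg_of_isTTSP famStarS_cert_par famStarS_cert_serL famStarS_cert_serR famStarS_cert_serS hE s hs hsx hsy w hw 0

/-- **THEOREM 𝒯₁ (`T_sym`) re-derived from the family induction** (agrees with `FK.tsym_nonneg` of `…TsymSP.lean`).
[cite: AyyerLinussonRavichandran2025, §7 (p. 22)] -/
theorem tsym2_nonneg (hE : IsTTSP E x y) (hs : ∃ e ∈ E, s ∈ e) (hsx : s ≠ x) (hsy : s ≠ y) {w : ℕ → ℝ}
    (hw : ∀ n, 0 ≤ w n) : 0 ≤ mval2 w E x y s tsym2Tab :=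
  fam_nonneg_of_isTTSP famTsym_cert_par famTsym_cert_serL famTsym_cert_serR famTsym_cert_serS hE s hs hsx hsy w hw 0

/-- **Levelwise count form of THEOREM 𝒯₁ (`STAR`, apex = a terminal)**: for every level `ν`,
`0 ≤ ∑_{γ : k+k̄ = ν} STAR₀(pat γ, pat γᶜ) + ∑_{γ : k+k̄+1 = ν} STAR₁(pat γ, pat γᶜ)` (= `2·STAR(x;y,s)(ν)` in ordered-table form).
[cite: AyyerLinussonRavichandran2025, §7 (p. 22)] -/
theorem starX_level_nonneg (hE : IsTTSP E x y) (hs : ∃ e ∈ E, s ∈ e) (hsx : s ≠ x) (hsy : s ≠ y) (ν : ℕ) :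
    0 ≤ (∑ γ ∈ E.powerset with apExp E γ = ν, starXTab 0 (pat3 γ x y s) (pat3 (E \ γ) x y s)) +
      ∑ γ ∈ E.powerset with apExp E γ + 1 = ν, starXTab 1 (pat3 γ x y s) (pat3 (E \ γ) x y s) := by
  have h := starX_nonneg hE hs hsx hsy (w := fun n => if n = ν then (1 : ℝ) else 0) (fun n => by split_ifs <;> norm_num)
  unfold mval2 at h
  rw [Finset.sum_filter, Finset.sum_filter]
  have : (0 : ℝ) ≤ ∑ γ ∈ E.powerset, (((if apExp E γ = ν then starXTab 0 (pat3 γ x y s) (pat3 (E \ γ) x y s) else 0 : ℤ) : ℝ) +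
      ((if apExp E γ + 1 = ν then starXTab 1 (pat3 γ x y s) (pat3 (E \ γ) x y s) else 0 : ℤ) : ℝ)) := by
    refine h.trans_eq (Finset.sum_congr rfl fun γ _ => ?_)
    by_cases h0 : apExp E γ = ν <;> by_cases h1 : apExp E γ + 1 = ν <;> simp [h0, h1]
  rw [Finset.sum_add_distrib] at this
  exact_mod_cast this

/-- **Levelwise count form of THEOREM 𝒯₁ (`STAR`, apex = the inner mark).** [cite: AyyerLinussonRavichandran2025, §7 (p. 22)] -/
theorem starS_level_nonneg (hE : IsTTSP E x y) (hs : ∃ e ∈ E, s ∈ e) (hsx : s ≠ x) (hsy : s ≠ y) (ν : ℕ) :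
    0 ≤ (∑ γ ∈ E.powerset with apExp E γ = ν, starSTab 0 (pat3 γ x y s) (pat3 (E \ γ) x y s)) +
      ∑ γ ∈ E.powerset with apExp E γ + 1 = ν, starSTab 1 (pat3 γ x y s) (pat3 (E \ γ) x y s) := by
  have h := starS_nonneg hE hs hsx hsy (w := fun n => if n = ν then (1 : ℝ) else 0) (fun n => by split_ifs <;> norm_num)
  unfold mval2 at h
  rw [Finset.sum_filter, Finset.sum_filter]
  have : (0 : ℝ) ≤ ∑ γ ∈ E.powerset, (((if apExp E γ = ν then starSTab 0 (pat3 γ x y s) (pat3 (E \ γ) x y s) else 0 : ℤ) : ℝ) +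
      ((if apExp E γ + 1 = ν then starSTab 1 (pat3 γ x y s) (pat3 (E \ γ) x y s) else 0 : ℤ) : ℝ)) := by
    refine h.trans_eq (Finset.sum_congr rfl fun γ _ => ?_)
    by_cases h0 : apExp E γ = ν <;> by_cases h1 : apExp E γ + 1 = ν <;> simp [h0, h1]
  rw [Finset.sum_add_distrib] at this
  exact_mod_cast this

end T1

section T2

variable [Fintype V] {E : Finset (Sym2 V)} {x y s : V}

/-- **THEOREM 𝒯₂ (census g34 PROOF-THEOREM-SP §3, house result — here a kernel theorem), with THEOREM 𝒯₁: every member of the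
family `famT12 = [T_sym, STAR_x, STAR_y, STAR_s, C1, C1~, C2, C2~, C3, C3~, S¹C1, S¹C1~, S¹C3, S¹C3~]` is nonnegative, for all
nonnegative weights (hence at every level), on every two-terminal series–parallel network `E` between `x` and `y` with an
inner third mark `s`.**  PROOF: `FK.fam_nonneg_of_isTTSP` with the four `decide`d family checks `famT12_cert_*` (census g35's
fibre normal form of g34's 32 closure certificates: each fibre termwise or dominating ONE (half-)member, possibly mirrored,
possibly one level up). [cite: AyyerLinussonRavichandran2025, §7 (p. 22)] [cite: Grimmett2006, §3.8 (pp. 61–62)] -/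
theorem famT12_nonneg (hE : IsTTSP E x y) (hs : ∃ e ∈ E, s ∈ e) (hsx : s ≠ x) (hsy : s ≠ y) {w : ℕ → ℝ}
    (hw : ∀ n, 0 ≤ w n) (i : ℕ) : 0 ≤ mval2 w E x y s (famGet famT12 i) :=
  fam_nonneg_of_isTTSP famT12_cert_par famT12_cert_serL famT12_cert_serR famT12_cert_serS hE s hs hsx hsy w hw i

/-- **THEOREM 𝒯₂, member `C1 = STAR₂`** (census g33's upper bound on the `T_sym` margin relative to the terminal port):
`0 ≤ mval2 w E x y s c1Tab`. [cite: AyyerLinussonRavichandran2025, §7 (p. 22)] -/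
theorem c1_nonneg (hE : IsTTSP E x y) (hs : ∃ e ∈ E, s ∈ e) (hsx : s ≠ x) (hsy : s ≠ y) {w : ℕ → ℝ}
    (hw : ∀ n, 0 ≤ w n) : 0 ≤ mval2 w E x y s c1Tab :=
  famT12_nonneg hE hs hsx hsy hw 4

/-- **THEOREM 𝒯₂, member `C2`**: `0 ≤ mval2 w E x y s c2Tab`. [cite: AyyerLinussonRavichandran2025, §7 (p. 22)] -/
theorem c2_nonneg (hE : IsTTSP E x y) (hs : ∃ e ∈ E, s ∈ e) (hsx : s ≠ x) (hsy : s ≠ y) {w : ℕ → ℝ}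
    (hw : ∀ n, 0 ≤ w n) : 0 ≤ mval2 w E x y s c2Tab :=
  famT12_nonneg hE hs hsx hsy hw 6

/-- **THEOREM 𝒯₂, member `C3`**: `0 ≤ mval2 w E x y s c3Tab`. [cite: AyyerLinussonRavichandran2025, §7 (p. 22)] -/
theorem c3_nonneg (hE : IsTTSP E x y) (hs : ∃ e ∈ E, s ∈ e) (hsx : s ≠ x) (hsy : s ≠ y) {w : ℕ → ℝ}
    (hw : ∀ n, 0 ≤ w n) : 0 ≤ mval2 w E x y s c3Tab :=
  famT12_nonneg hE hs hsx hsy hw 8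

/-- **THEOREM 𝒯₂, member `S¹C1`**: `0 ≤ mval2 w E x y s s1c1Tab`. [cite: AyyerLinussonRavichandran2025, §7 (p. 22)] -/
theorem s1c1_nonneg (hE : IsTTSP E x y) (hs : ∃ e ∈ E, s ∈ e) (hsx : s ≠ x) (hsy : s ≠ y) {w : ℕ → ℝ}
    (hw : ∀ n, 0 ≤ w n) : 0 ≤ mval2 w E x y s s1c1Tab :=
  famT12_nonneg hE hs hsx hsy hw 10

/-- **THEOREM 𝒯₂, member `S¹C3`**: `0 ≤ mval2 w E x y s s1c3Tab`. [cite: AyyerLinussonRavichandran2025, §7 (p. 22)] -/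
theorem s1c3_nonneg (hE : IsTTSP E x y) (hs : ∃ e ∈ E, s ∈ e) (hsx : s ≠ x) (hsy : s ≠ y) {w : ℕ → ℝ}
    (hw : ∀ n, 0 ≤ w n) : 0 ≤ mval2 w E x y s s1c3Tab :=
  famT12_nonneg hE hs hsx hsy hw 12

/-- **The mirrored members** (`C1~, C2~, C3~, S¹C1~, S¹C3~`, i.e. the members with `x ↔ y` exchanged): e.g.
`0 ≤ mval2 w E x y s (mirror2 c1Tab)`; all five at once as members `5, 7, 9, 11, 13` of `famT12`.
[cite: AyyerLinussonRavichandran2025, §7 (p. 22)] -/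
theorem c1_mirror_nonneg (hE : IsTTSP E x y) (hs : ∃ e ∈ E, s ∈ e) (hsx : s ≠ x) (hsy : s ≠ y) {w : ℕ → ℝ}
    (hw : ∀ n, 0 ≤ w n) : 0 ≤ mval2 w E x y s (mirror2 c1Tab) :=
  famT12_nonneg hE hs hsx hsy hw 5

end T2

end FK

end Summit.CriticalPhenomena.PercolationContinuityZ3.Theorems

end
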